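import Mathlib
import HarnessLib
import Summits.FinalStateConjecture.FinalStateConjecture.Theses.BondiDrainDispersal
import Summits.FinalStateConjecture.FinalStateConjecture.Theorems.BondiDrainDispersalDrainImpliesDisperseStubHonestEnd
import Literature.Geometry.Lorentzian.NormalisedNullRayCausal

/-!
# Crux `DrainImpliesDisperse` (stmt-FinalStateConjecture-17283), line `registered` — REDUCTION of the
# crux to its analytic core: a horizonless radiative end settles the development honestly (`N = 0`)

Lead c2, 2026-08-17 (skeleton reshape r2). The line cuts the crux
`Theses.BondiDrainDispersal.DrainImpliesDisperse` (Bondi mass drains ⇒ honest `N = 0` decomposition with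
the Statement's T2 clauses) along the one object every proof of it passes through — a HORIZONLESS
RADIATIVE END `(τ₀, Ψ)` of the development: a chart `Ψ : E4 → M` of the flat background which is
(E1) smooth and an open embedding of the late half-space `{x⁰ > τ₀}`, (E2) PROPER (`Ψ{x⁰ ≥ τ₀}` closed),
(E3) late (`U := Ψ{x⁰ > τ₀} ⊆ J⁺(ι X)`), (E4) future-timelike-fibred (`Ψ_*∂₀` future timelike on
`{x⁰ ≥ τ₀}`), (E5) `C²`-decaying on ENTIRE slabs (`deviationCk … 2 τ → 0`), and (E6) WITHOUT HORIZON
(`J⁺(ι X) ⊆ I⁻(U)`: every event to the future of the data can signal to the end). This file proves, sorry-free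
and for EVERY Cauchy development (no maximality, no field equation, no decay beyond (E5) is used):

* `settles_of_horizonlessRadiativeEnd` — a horizonless radiative end yields the crux's conclusion verbatim:
  `∃ O d, d.N = 0 ∧ O = exteriorOf 𝒟 d.charted ∧ RaysStayInClosure 𝒟 O ∧ HasExhaustiveCharts d ∧
  IsFutureOriented d` (the `N = 0` decomposition has `flatDomain = ⊤`, `flatChart = Ψ`, `O = exteriorOf 𝒟 U`;
  honesty (H1)/(H2) is the landed `stub_honestEnd`; rays: a ray point `γ t`, `t ≥ 0`, lies in `J⁺(ι X)`
  (`IsNormalisedNullRayFrom.mem_causalFuture_range`) hence in `I⁻(U)` by (E6); exhaustion = (H2);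
  future orientation = (E4) eventually);
* `drainImpliesDisperse_of_horizonlessRadiativeEnd` — the crux BY NAME from the single remaining analytic
  statement HORIZONLESS RADIATIVE END EXISTS (drain + complete `𝓘⁺` + MGHD of admissible data ⇒
  `∃ τ₀ Ψ`, (E1)–(E6)), stated unfolded; this is the registered stub `stub_radiativeEnd` of the skeleton
  (`Cruxes/DrainImpliesDisperse/Lines/birth.lean`, reshape r2), the crux's open-problem content
  (hyperboloidal positive-mass stability + 'a bubble is a hole or nothing' + weak-to-`C²` dispersive endgame;
  DongSong2024, LukOh2022), so that a planner's split of the crux is the one-line `exact` of this theorem.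

Why (E6) and not the birth skeleton's separate 'complete rays signal to `U`' stub: as typed that stub is
unprovable over ALL data (massless-hole channel; nothing in drain/complete-`𝓘⁺`/maximality locates a
complete ray relative to `U`), and under the route's ray-theoretic no-horizon hypothesis it is EQUIVALENT to
(E6) (worker verdict 2026-08-17, Lean-checked); (E6) is therefore the honest form of "no black hole" for a
dispersing development, and with it `exteriorOf 𝒟 U = J⁺(ι X)`.

Mathlib + the Statement/route cone + the landed `stub_honestEnd`; no definitions, no named facts.
-/

noncomputable section

open scoped Manifold ContDiff Topology
open Filter Set Topology TopologicalSpace Literature.Geometry.Lorentzian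

namespace Summit.FinalStateConjecture.FinalStateConjecture.Theorems.DrainImpliesDisperse

-- D-0017: single-problem summit, `Summit.<S>.<S>.…` by design
-- (cf. lakefile `weak.linter.dupNamespace`).
set_option linter.dupNamespace false

/-- **A horizonless radiative end settles the development honestly (`N = 0`).** For every Cauchy
development `𝒟` and every chart `Ψ : E4 → M` of the flat background which is smooth, an open embedding of
`{x⁰ > τ₀}`, proper on `{x⁰ ≥ τ₀}`, maps `U := Ψ{x⁰ > τ₀}` into `J⁺(ι X)`, has `Ψ_*∂₀` future timelike on
`{x⁰ ≥ τ₀}`, `C²`-converges to `η` on the entire slabs `{x⁰ = τ}`, and has no horizon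
(`J⁺(ι X) ⊆ I⁻(U)`), there are `O` (namely `exteriorOf 𝒟 U`) and an `N = 0` final-state decomposition `d`
of `O` in `C²` (flat domain all of `E4`, flat chart `Ψ`) with `O = exteriorOf 𝒟 d.charted`,
`RaysStayInClosure 𝒟 O`, `HasExhaustiveCharts d` and `IsFutureOriented d` — the `N = 0` conclusion of the
re-typed Statement, verbatim. Honesty (covering at `τ₀`, exhaustion at every `τ₁ > τ₀`, `U ⊆ I⁻(U)`) is the
landed `stub_honestEnd`; the ray clause is (E6) after `IsNormalisedNullRayFrom.mem_causalFuture_range`. -/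
theorem settles_of_horizonlessRadiativeEnd :
    ∀ (X : Type) [TopologicalSpace X] [ChartedSpace E3 X] [IsManifold (𝓡 3) ∞ X] [ConnectedSpace X]
      (D : InitialDataSet (𝓡 3) X) (𝒟 : CauchyDevelopment D) (τ₀ : ℝ)
      (Ψ : Minkowski.background.domain → 𝒟.carrier),
      ContMDiff 𝓘(ℝ, E4) (𝓡 4) ∞ Ψ →
      IsOpenEmbedding ((Minkowski.background.lateRegion τ₀).restrict Ψ) →
      IsClosed (Ψ '' {x : Minkowski.background.domain | τ₀ ≤ x.1 0}) →
      Ψ '' Minkowski.background.lateRegion τ₀ ⊆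
        𝒟.metric.causalFuture 𝒟.timeOrientation (range 𝒟.embed) →
      (∀ x : Minkowski.background.domain, τ₀ ≤ x.1 0 →
        𝒟.metric.IsTimelike (mfderiv 𝓘(ℝ, E4) (𝓡 4) Ψ x (E4.basisVector 0)) ∧
        𝒟.timeOrientation.IsFutureDirected (mfderiv 𝓘(ℝ, E4) (𝓡 4) Ψ x (E4.basisVector 0))) →
      Tendsto (fun τ ↦ 𝒟.toSpacetime.deviationCk Minkowski.background Ψ 2 τ) atTop (𝓝 0) →
      𝒟.metric.causalFuture 𝒟.timeOrientation (range 𝒟.embed) ⊆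
        𝒟.metric.chronologicalPast 𝒟.timeOrientation (Ψ '' Minkowski.background.lateRegion τ₀) →
      ∃ (O : Set 𝒟.carrier) (d : FinalStateDecomposition 𝒟.toSpacetime O 2),
        d.N = 0 ∧ O = exteriorOf 𝒟 d.charted ∧ RaysStayInClosure 𝒟 O ∧ HasExhaustiveCharts d ∧
          IsFutureOriented d := by
  intro X _ _ _ _ D 𝒟 τ₀ Ψ hsm hemb hcl hJ hT hdec hE6
  obtain ⟨hself, hexh⟩ := stub_honestEnd X D 𝒟 τ₀ Ψ hsm hemb hcl hT
  -- the late chart into `O := exteriorOf 𝒟 U`, `U := Ψ{x⁰ > τ₀}`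
  let O : Set 𝒟.carrier := exteriorOf 𝒟 (Ψ '' Minkowski.background.lateRegion τ₀)
  have hlate : 𝒟.toSpacetime.IsLateChart Minkowski.background O τ₀ Ψ :=
    ⟨hsm, hemb, Set.subset_inter hJ hself⟩
  -- the `N = 0` decomposition of `O`: no holes, flat domain all of `E4`, flat chart `Ψ`
  let d : FinalStateDecomposition 𝒟.toSpacetime O 2 :=
    { N := 0
      mass := Fin.elim0
      spin := Fin.elim0
      mass_pos := fun i ↦ i.elim0
      abs_spin_le_mass := fun i ↦ i.elim0
      motion := Fin.elim0
      τ₀ := τ₀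
      chart := fun i ↦ i.elim0
      isLateChart := fun i ↦ i.elim0
      tendsto_truncDeviationCk := fun i ↦ i.elim0
      exists_pairwise_disjoint := fun _ ↦ ⟨0, fun i ↦ i.elim0⟩
      excision := Fin.elim0
      tendsto_excision_div := fun i ↦ i.elim0
      flatDomain := ⊤
      setOf_lt_excision_subset_flatDomain := fun _ _ ↦ trivial
      flatChart := Ψ
      isLateChart_flat := hlate
      tendsto_deviationCk_flat := hdec
      diff_subset_causalPast := by
        intro p hp
        have hp2 : p ∉ Ψ '' Minkowski.background.lateRegion τ₀ := fun h' ↦ hp.2 (Or.inr h')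
        exact LorentzianMetric.causalFuture_mono subset_union_right (hexh τ₀ le_rfl ⟨hp.1, hp2⟩) }
  have hch : d.charted = Ψ '' Minkowski.background.lateRegion τ₀ := by
    ext p
    simp only [FinalStateDecomposition.charted, Set.mem_union, Set.mem_iUnion]
    constructor
    · rintro (h' | ⟨i, -⟩)
      · exact h'
      · exact i.elim0
    · exact fun h' ↦ Or.inl h'
  refine ⟨O, d, rfl, ?_, ?_, ⟨fun i ↦ i.elim0, fun i ↦ i.elim0, fun i ↦ i.elim0, fun τ₁ hτ₁ ↦ ?_⟩,
    ⟨fun i ↦ i.elim0, fun i ↦ i.elim0, ?_⟩⟩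
  · -- `O = exteriorOf 𝒟 d.charted`
    rw [hch]
  · -- `RaysStayInClosure 𝒟 O`: ray points `γ t`, `t ≥ 0`, lie in `J⁺(ι X) ⊆ I⁻(U)`
    intro _ p γ dom hγ _ t ht ht0
    exact subset_closure ⟨hγ.mem_causalFuture_range ht ht0, hE6 (hγ.mem_causalFuture_range ht ht0)⟩
  · -- `HasExhaustiveCharts d` at chart time `τ₁ > τ₀`: the certified pieces are the flat ones, (H2)
    intro p hp
    have hp2 : p ∉ Ψ '' Minkowski.background.lateRegion τ₁ := fun h' ↦ hp.2 (Or.inl h')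
    exact LorentzianMetric.causalFuture_mono subset_union_left (hexh τ₁ (le_of_lt hτ₁) ⟨hp.1, hp2⟩)
  · -- `IsFutureOriented d`: the flat clause is (E4) eventually in `τ ≥ τ₀`
    filter_upwards [Filter.eventually_ge_atTop τ₀] with τ hτ x hx
    have hx' : (x.1 : E4) 0 = τ := hx
    exact (hT x (hτ.trans_eq hx'.symm)).2

/-- **The crux `DrainImpliesDisperse` from the existence of horizonless radiative ends, BY NAME.** If every
maximal vacuum Cauchy development of an admissible datum with complete future null infinity (sojourn form)
and vanishing final Bondi mass carries a horizonless radiative end `(τ₀, Ψ)` — (E1) `Ψ : E4 → M` smooth and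
an open embedding of `{x⁰ > τ₀}`, (E2) `Ψ{x⁰ ≥ τ₀}` closed, (E3) `Ψ{x⁰ > τ₀} ⊆ J⁺(ι X)`, (E4) `Ψ_*∂₀`
future timelike on `{x⁰ ≥ τ₀}`, (E5) `deviationCk Minkowski.background Ψ 2 τ → 0`, (E6)
`J⁺(ι X) ⊆ I⁻(Ψ{x⁰ > τ₀})` — then `Theses.BondiDrainDispersal.DrainImpliesDisperse` holds. The hypothesis
is the registered stub `stub_radiativeEnd` of line `registered` (reshape r2), verbatim: the crux's analytic
core (drain ⇒ a proper, future-timelike-fibred, `C²`-decaying, horizonless global flat late chart; intended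
engine: hyperboloidal Dong–Song positive-mass stability, 'a bubble is a hole or nothing', Luk–Oh-type
weak-to-`C²` dispersive endgame — an open problem). Pure logic over `settles_of_horizonlessRadiativeEnd`. -/
theorem drainImpliesDisperse_of_horizonlessRadiativeEnd :
    (∀ (X : Type) [TopologicalSpace X] [ChartedSpace E3 X] [IsManifold (𝓡 3) ∞ X] [T2Space X]
      [SecondCountableTopology X] [ConnectedSpace X],
      ∀ D ∈ admissibleVacuumData X, ∀ 𝒟 : VacuumCauchyDevelopment D, 𝒟.IsMaximal →
        Summit.FinalStateConjecture.HasCompleteNullInfinity 𝒟.toCauchyDevelopment →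
        𝒟.toCauchyDevelopment.HasVanishingFinalBondiMass →
        ∃ (τ₀ : ℝ) (Ψ : Minkowski.background.domain → 𝒟.carrier),
          ContMDiff 𝓘(ℝ, E4) (𝓡 4) ∞ Ψ ∧
          IsOpenEmbedding ((Minkowski.background.lateRegion τ₀).restrict Ψ) ∧
          IsClosed (Ψ '' {x : Minkowski.background.domain | τ₀ ≤ x.1 0}) ∧
          Ψ '' Minkowski.background.lateRegion τ₀ ⊆
            𝒟.metric.causalFuture 𝒟.timeOrientation (range 𝒟.embed) ∧
          (∀ x : Minkowski.background.domain, τ₀ ≤ x.1 0 →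
            𝒟.metric.IsTimelike (mfderiv 𝓘(ℝ, E4) (𝓡 4) Ψ x (E4.basisVector 0)) ∧
            𝒟.timeOrientation.IsFutureDirected (mfderiv 𝓘(ℝ, E4) (𝓡 4) Ψ x (E4.basisVector 0))) ∧
          Tendsto (fun τ ↦ 𝒟.toSpacetime.deviationCk Minkowski.background Ψ 2 τ) atTop (𝓝 0) ∧
          𝒟.metric.causalFuture 𝒟.timeOrientation (range 𝒟.embed) ⊆
            𝒟.metric.chronologicalPast 𝒟.timeOrientation
              (Ψ '' Minkowski.background.lateRegion τ₀)) →
    Theses.BondiDrainDispersal.DrainImpliesDisperse := by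
  intro h X _ _ _ _ _ _ D hD 𝒟 h𝒟 hI hB
  obtain ⟨τ₀, Ψ, hsm, hemb, hcl, hJ, hT, hdec, hE6⟩ := h X D hD 𝒟 h𝒟 hI hB
  exact settles_of_horizonlessRadiativeEnd X D 𝒟.toCauchyDevelopment τ₀ Ψ hsm hemb hcl hJ hT hdec hE6

end Summit.FinalStateConjecture.FinalStateConjecture.Theorems.DrainImpliesDisperse

end
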